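import Summits.MatrixMultiplication.MatrixMultiplication.Theorems.LevelGradedCohnUmansLevelOneGL2DesignsParabolaFreeExact
import Summits.MatrixMultiplication.MatrixMultiplication.Theorems.LevelGradedCohnUmansLevelOneGL2DesignsParabolaFreeExact11CapThree
import Summits.MatrixMultiplication.MatrixMultiplication.Theorems.LevelGradedCohnUmansLevelOneGL2DesignsParabolaFreeExact11CapFour

/-!
# Parabola-free sets of `ℤ₁₁²`: the exact value `α₁₁ = 23`
(stub `stub_tangencySets` of the crux `LevelOneGL2Designs`, stmt-MatrixMultiplication-14080;
wall-breaker axis 5/12, *parabola lifts over finite fields*, family P2-mod)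

The remaining search verdicts at `p = 11`, `K = 24` (largest column of size `m = 1, 2` and
`m ≥ 5`: cheap), the per-`p` table and square-root checks, and the assembly through
`PFS.no_parabolaFree`: **no parabola-free subset of `ℤ₁₁ × ℤ₁₁` has 24 points** (planner sub-stub
`stub_parabolaFreeAt_11_not_24`).  With the 23-point witness `stub_parabolaFreeAt_11_23`
(`…ParabolaFreeInstances.lean`), `α₁₁ = 23 = 2·11 + 1`: at `p = 11` wrap-around parabola lifts
beat every parabola pencil (`≤ 11` points, `11 ≡ 3 mod 4`) and every integer (no-wrap) lift, but
stay far below `11^{3/2} ≈ 36.5` (Hoffman bound of the parabola Cayley graph: 34.7).  All kernel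
`decide`; no `native_decide`.
-/

set_option linter.dupNamespace false -- `MatrixMultiplication.MatrixMultiplication` (summit = problem, D-0017)

namespace Summit.MatrixMultiplication.MatrixMultiplication.Theorems.LevelOneGL2Designs.PFS

/-- popcount table check at `p = 11` -/
theorem pc_eleven : ∀ m < 2 ^ 11, pc 11 m = (bitsOf 11 m).length := by decide +kernel

/-- neighbourhood table check at `p = 11` -/
theorem nbT_eleven : ∀ x < 11, ∀ i < 11, nbT 11 x i = nb 11 x i := by decide +kernel

/-- every non-zero residue mod `11` is `±` a non-zero square -/
theorem sq_eleven : ∀ η : ℕ, 1 ≤ η → η < 11 → ∃ u : ZMod 11, u ≠ 0 ∧ (u ^ 2 = η ∨ -u ^ 2 = η) := by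
  intro η h1 h11
  interval_cases η <;> decide

/-- search verdicts at `p = 11`, `K = 24` for a largest column of size `1` or `2` (immediate from
the bound) -/
theorem refuteM_11_24_le_two : ∀ m, 1 ≤ m → m ≤ 2 → refuteM 11 24 m = true := by
  intro m h1 h2
  interval_cases m <;> decide +kernel

/-- search verdict at `p = 11`, `K = 24`, largest column of size 5 (22 canonical column-0 sets,
9440 nodes) -/
theorem refuteM_11_24_5 : refuteM 11 24 5 = true := by decide +kernel

/-- search verdict at `p = 11`, `K = 24`, largest column of size 6 (26 canonical sets, 257 nodes) -/
theorem refuteM_11_24_6 : refuteM 11 24 6 = true := by decide +kernel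

/-- search verdicts at `p = 11`, `K = 24`, largest column of size `7 … 11` (the bound alone) -/
theorem refuteM_11_24_ge_seven : ∀ m, 7 ≤ m → m ≤ 11 → refuteM 11 24 m = true := by
  intro m h7 h11
  interval_cases m <;> decide +kernel

/-- all search verdicts at `p = 11`, `K = 24` -/
theorem refuteM_eleven : ∀ m, 1 ≤ m → m ≤ 11 → refuteM 11 24 m = true := by
  intro m h1 h11
  rcases Nat.lt_or_ge m 3 with h | h
  · exact refuteM_11_24_le_two m h1 (by omega)
  rcases Nat.lt_or_ge m 4 with h' | h'
  · obtain rfl : m = 3 := by omega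
    exact refuteM_11_24_3
  rcases Nat.lt_or_ge m 5 with h'' | h''
  · obtain rfl : m = 4 := by omega
    exact refuteM_11_24_4
  rcases Nat.lt_or_ge m 6 with h3 | h3
  · obtain rfl : m = 5 := by omega
    exact refuteM_11_24_5
  rcases Nat.lt_or_ge m 7 with h4 | h4
  · obtain rfl : m = 6 := by omega
    exact refuteM_11_24_6
  exact refuteM_11_24_ge_seven m h4 h11

/-- **Exact value `α₁₁ = 23`** (planner sub-stub `stub_parabolaFreeAt_11_not_24`, siege plan of
stmt-14080, family P2-mod): no parabola-free subset of `ℤ₁₁ × ℤ₁₁` has 24 points.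
[computation, kernel `decide`; ≈ 1.45·10⁵ search nodes] -/
theorem stub_parabolaFreeAt_11_not_24 : ¬ ∃ T : Finset (ZMod 11 × ZMod 11), 24 ≤ T.card ∧
    ∀ t ∈ T, ∀ t' ∈ T, (t'.1 - t.1) ^ 2 = t.2 - t'.2 → t'.1 = t.1 :=
  no_parabolaFree (p := 11) (hp := ⟨by norm_num⟩) (by norm_num) (by norm_num) pc_eleven nbT_eleven sq_eleven
    refuteM_eleven

end Summit.MatrixMultiplication.MatrixMultiplication.Theorems.LevelOneGL2Designs.PFS
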